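import Summits.CriticalPhenomena.PercolationContinuityZ3.Theorems.SahiThreeCoordinates

/-!
# Sahi's `C_n` for NONINCREASING observables of at most three coordinates; the Ising down-spin `C₃`

Companion of `SahiThreeCoordinates.lean` (cell `prim-sahi`, typer; `--supports stmt-CriticalPhenomena-4575`).
Theorems only (no definitions, no named facts, no sorries).

Sahi positivity (`SahiPositive μ n`) is stated for nondecreasing functions; for NONINCREASING nonnegative families
one passes to the order dual `Lᵒᵈ`: the FKG lattice condition is symmetric in `⊓`, `⊔` (`isFKGMeasure_dual`) and
`E_n` only sees sums (`sahiE_dual`, by `rfl`).  The settled targets of `SahiThreeCoordinates.lean` have settled duals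
(`({0,1}³)ᵒᵈ ↪ {0,1}³` by complement, `({−1,+1}³)ᵒᵈ ↪ {0,1}³` by the down-spin reading), so:
* `sahiE_comp_nonneg_of_forall_isFKGMeasure_dual` — antitone families through a lattice hom with settled dual target;
* `sahiE_nonneg_of_threeCoordinates_antitone` — `{0,1}^ι`, any FKG weight, observables NONINCREASING in ≤ 3 fixed
  coordinates, every `n`;
* `ising_sahiE_threeSites_nonneg_of_antitone`, `isingExpect_sahiC3_threeSites_down` — the Ising ferromagnet
  (`β ≥ 0`, ANY field, ANY boundary condition): `C_n` for nonincreasing functions of three spins, and the `C₃` of the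
  three DOWN-spin indicators `(1 − σ_u)/2` in spin correlations,
  `0 ≤ −2⟨σ_xσ_yσ_z⟩ + Σ⟨σσ⟩ − ⟨σ_x⟩⟨σ_y⟩⟨σ_z⟩ + Σ_cyc ⟨σ_x⟩⟨σ_yσ_z⟩ − Σ ⟨σ⟩⟨σ⟩`, i.e.
  `U₃(x,y,z) ≤ ½ Σ_cyc (1 − m_x)⟨σ_y;σ_z⟩`.  Together with `isingExpect_sahiC3_threeSites`:
  `−½ Σ_cyc (1 + m_x)⟨σ_y;σ_z⟩ ≤ U₃(x,y,z) ≤ ½ Σ_cyc (1 − m_x)⟨σ_y;σ_z⟩` for every field and boundary condition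
  (GHS, `isingExpect_ghs`, sharpens the upper bound to `0` when `h ≥ 0` with free/`+` b.c.).
-/

noncomputable section

namespace Summit.CriticalPhenomena.PercolationContinuityZ3.Theorems.SahiThreeCoordinates

open Finset Literature.Combinatorics.Sahi2008

section Dual

/-- An FKG probability weight is an FKG probability weight on the order dual. -/
theorem isFKGMeasure_dual {L : Type*} [Fintype L] [Lattice L] {μ : L → ℝ} (hμ : IsFKGMeasure μ) :
    IsFKGMeasure fun x : Lᵒᵈ => μ (OrderDual.ofDual x) := by
  refine ⟨fun x => hμ.nonneg _, hμ.sum_eq_one, fun a b => ?_⟩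
  rw [mul_comm (μ (OrderDual.ofDual (a ⊓ b)))]
  exact hμ.mul_le_mul (OrderDual.ofDual a) (OrderDual.ofDual b)

/-- `E_n` is unchanged by passing to the order dual (same weight, same functions, same sums). -/
theorem sahiE_dual {L : Type*} [Fintype L] (μ : L → ℝ) (n : ℕ) (f : Fin n → L → ℝ) :
    sahiE (fun x : Lᵒᵈ => μ (OrderDual.ofDual x)) n (fun i x => f i (OrderDual.ofDual x)) = sahiE μ n f :=
  rfl

variable {β γ : Type*} [Fintype β] [DistribLattice β] [Fintype γ] [Lattice γ]

/-- **Antitone families through a lattice homomorphism whose target has a settled dual**: for every FKG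
probability weight `μ` on a finite distributive lattice, `G : β → γ` a lattice hom, and nonnegative ANTITONE
`f₀,…,f_{n−1} : γ → ℝ`: `E_n^μ(f₀ ∘ G,…) ≥ 0` provided every FKG weight on `γᵒᵈ` is Sahi-positive of order `n`. -/
theorem sahiE_comp_nonneg_of_forall_isFKGMeasure_dual {μ : β → ℝ} (hμ : IsFKGMeasure μ) (G : LatticeHom β γ)
    {n : ℕ} (hγ : ∀ ν : γᵒᵈ → ℝ, IsFKGMeasure ν → SahiPositive ν n) (f : Fin n → γ → ℝ)
    (hf0 : ∀ i c, 0 ≤ f i c) (hanti : ∀ i, Antitone (f i)) : 0 ≤ sahiE μ n fun i => f i ∘ G :=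
  sahiE_comp_nonneg_of_forall_isFKGMeasure (isFKGMeasure_dual hμ) (LatticeHom.dual G) hγ
    (fun i y => f i (OrderDual.ofDual y)) (fun i _ => hf0 i _) (fun i => (hanti i).dual_left)

/-- The dual cube `({0,1}³)ᵒᵈ` is settled: it embeds into `{0,1}³` by complement (de Morgan), so P1's
`sahiPositive_cube_three` transfers along `SahiSettledClass.sahiPositive_of_latticeEmbedding`. -/
theorem sahiPositive_cube_three_dual {ν : (Fin 3 → Bool)ᵒᵈ → ℝ} (hν : IsFKGMeasure ν) (n : ℕ) :
    SahiPositive ν n := by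
  refine SahiSettledClass.sahiPositive_of_latticeEmbedding (L := (Fin 3 → Bool)ᵒᵈ) (P := Fin 3 → Bool)
    (fun y a => !(OrderDual.ofDual y a)) ?_ ?_ ?_
    (fun _ hρ => SahiCubeAllOrders.sahiPositive_cube_three hρ) hν n
  · intro y y' hyy'
    have h : OrderDual.ofDual y = OrderDual.ofDual y' := by
      funext a
      have ha := congrFun hyy' a
      simpa using ha
    exact h
  · intro y y'
    funext a
    show (!(OrderDual.ofDual y a || OrderDual.ofDual y' a)) = (!(OrderDual.ofDual y a) && !(OrderDual.ofDual y' a))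
    exact Bool.not_or _ _
  · intro y y'
    funext a
    show (!(OrderDual.ofDual y a && OrderDual.ofDual y' a)) = (!(OrderDual.ofDual y a) || !(OrderDual.ofDual y' a))
    exact Bool.not_and _ _

/-- **Three coordinates of `{0,1}^ι`, antitone version**: nonnegative observables depending NONINCREASINGLY on at
most three fixed coordinates of an arbitrary FKG weight have `E_n ≥ 0`, every `n`. -/
theorem sahiE_nonneg_of_threeCoordinates_antitone {ι : Type*} [Fintype ι] [DecidableEq ι]
    {μ : (ι → Bool) → ℝ} (hμ : IsFKGMeasure μ) (e : Fin 3 → ι) (n : ℕ) (g : Fin n → (Fin 3 → Bool) → ℝ)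
    (hg0 : ∀ i y, 0 ≤ g i y) (hanti : ∀ i, Antitone (g i)) : 0 ≤ sahiE μ n fun i ω => g i (ω ∘ e) :=
  sahiE_comp_nonneg_of_forall_isFKGMeasure_dual hμ
    { toFun := fun ω : ι → Bool => ω ∘ e, map_sup' := fun _ _ => rfl, map_inf' := fun _ _ => rfl }
    (fun _ hν => sahiPositive_cube_three_dual hν n) g hg0 hanti

open MeasureTheory Literature.Probability.LatticeModels

/-- In `ℤˣ`: `x ⊔ y = −1 ↔ x = −1 ∧ y = −1`. -/
theorem units_sup_eq_neg_one_iff (x y : ℤˣ) : x ⊔ y = -1 ↔ x = -1 ∧ y = -1 := by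
  revert x y
  decide

/-- In `ℤˣ`: `x ⊓ y = −1 ↔ x = −1 ∨ y = −1`. -/
theorem units_inf_eq_neg_one_iff (x y : ℤˣ) : x ⊓ y = -1 ↔ x = -1 ∨ y = -1 := by
  revert x y
  decide

/-- The dual spin cube `({−1,+1}³)ᵒᵈ` is settled: the down-spin reading `y ↦ (y_a = −1)_a` embeds it into `{0,1}³`. -/
theorem sahiPositive_spinCube_three_dual {ν : (Fin 3 → ℤˣ)ᵒᵈ → ℝ} (hν : IsFKGMeasure ν) (n : ℕ) :
    SahiPositive ν n := by
  refine SahiSettledClass.sahiPositive_of_latticeEmbedding (L := (Fin 3 → ℤˣ)ᵒᵈ) (P := Fin 3 → Bool)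
    (fun y a => decide (OrderDual.ofDual y a = -1)) ?_ ?_ ?_
    (fun _ hρ => SahiCubeAllOrders.sahiPositive_cube_three hρ) hν n
  · intro y y' hyy'
    have h : OrderDual.ofDual y = OrderDual.ofDual y' := by
      funext a
      have ha := congrFun hyy' a
      simp only [decide_eq_decide] at ha
      rcases Int.units_eq_one_or (OrderDual.ofDual y a) with h1 | h1 <;>
        rcases Int.units_eq_one_or (OrderDual.ofDual y' a) with h2 | h2
      · rw [h1, h2]
      · exact absurd (ha.2 h2) (by rw [h1]; decide)
      · exact absurd (ha.1 h1) (by rw [h2]; decide)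
      · rw [h1, h2]
    exact h
  · intro y y'
    funext a
    show decide ((OrderDual.ofDual y ⊔ OrderDual.ofDual y') a = -1) =
      (decide (OrderDual.ofDual y a = -1) && decide (OrderDual.ofDual y' a = -1))
    rw [Pi.sup_apply, ← Bool.decide_and, decide_eq_decide, units_sup_eq_neg_one_iff]
  · intro y y'
    funext a
    show decide ((OrderDual.ofDual y ⊓ OrderDual.ofDual y') a = -1) =
      (decide (OrderDual.ofDual y a = -1) || decide (OrderDual.ofDual y' a = -1))
    rw [Pi.inf_apply, ← Bool.decide_or, decide_eq_decide, units_inf_eq_neg_one_iff]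

variable {V : Type*} (Gr : SimpleGraph V) [DecidableEq V] [Gr.LocallyFinite]

/-- **Ising, three sites, every order — nonincreasing observables.**  As `ising_sahiE_threeSites_nonneg`, for
nonnegative functions of `(σ_{v₀}, σ_{v₁}, σ_{v₂})` that are NONINCREASING in each spin. -/
theorem ising_sahiE_threeSites_nonneg_of_antitone (Λ : Finset V) {β : ℝ} (hβ : 0 ≤ β) (h : ℝ)
    (bc : BoundaryCondition V) (v : Fin 3 → V) (n : ℕ) (g : Fin n → (Fin 3 → ℤˣ) → ℝ)
    (hg0 : ∀ i y, 0 ≤ g i y) (hanti : ∀ i, Antitone (g i)) :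
    0 ≤ sahiE (fun τ : Λ → ℤˣ => isingWeight Gr Λ β h bc τ / isingPartitionFunction Gr Λ β h bc) n
      fun i τ => g i fun a => glue Λ τ bc (v a) :=
  sahiE_comp_nonneg_of_forall_isFKGMeasure_dual (isFKGMeasure_isingGibbsWeight Gr Λ hβ h bc)
    { toFun := fun (τ : Λ → ℤˣ) (a : Fin 3) => glue Λ τ bc (v a)
      map_sup' := fun τ τ' => by funext a; simp only [glue_sup, Pi.sup_apply]
      map_inf' := fun τ τ' => by funext a; simp only [glue_inf, Pi.inf_apply] }
    (fun _ hν => sahiPositive_spinCube_three_dual hν n) g hg0 hanti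

/-- `(1 − y_a)/2 ∈ {0,1}` is nonnegative. -/
theorem half_one_sub_units_nonneg (u : ℤˣ) : 0 ≤ (1 - ((u : ℤ) : ℝ)) / 2 := by
  rcases Int.units_eq_one_or u with h1 | h1 <;> simp [h1]

/-- `y ↦ (1 − y_a)/2` is nonincreasing on `{−1,+1}³`. -/
theorem antitone_half_one_sub_apply (a : Fin 3) :
    Antitone fun y : Fin 3 → ℤˣ => (1 - ((y a : ℤ) : ℝ)) / 2 := by
  intro y y' hyy'
  have hm := monotone_half_one_add_apply a hyy'
  dsimp only at hm ⊢
  linarith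

/-- `E(−s) = −E(s)`. -/
theorem ex_neg' {α : Type*} [Fintype α] (μ s : α → ℝ) : ex μ (fun x => -s x) = -ex μ s := by
  simp only [ex, mul_neg, Finset.sum_neg_distrib]

/-- **Single-site `C₃` of the Ising ferromagnet for the DOWN-spin indicators** `(1 − σ_u)/2` (`β ≥ 0`, ANY field,
ANY boundary condition, any sites):
`0 ≤ −2⟨σ_xσ_yσ_z⟩ + ⟨σ_xσ_y⟩ + ⟨σ_xσ_z⟩ + ⟨σ_yσ_z⟩ − ⟨σ_x⟩⟨σ_y⟩⟨σ_z⟩ + ⟨σ_x⟩⟨σ_yσ_z⟩ + ⟨σ_y⟩⟨σ_xσ_z⟩ + ⟨σ_z⟩⟨σ_xσ_y⟩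
   − ⟨σ_x⟩⟨σ_y⟩ − ⟨σ_x⟩⟨σ_z⟩ − ⟨σ_y⟩⟨σ_z⟩`,
equivalently `U₃(x,y,z) ≤ ½ Σ_cyc (1 − ⟨σ_x⟩)(⟨σ_yσ_z⟩ − ⟨σ_y⟩⟨σ_z⟩)`.  With `isingExpect_sahiC3_threeSites`:
`−½ Σ_cyc (1 + m_x)⟨σ_y;σ_z⟩ ≤ U₃ ≤ ½ Σ_cyc (1 − m_x)⟨σ_y;σ_z⟩` for every field and boundary condition (GHS sharpens
the upper bound to `0` when `h ≥ 0` with free/`+` b.c.). -/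
theorem isingExpect_sahiC3_threeSites_down (Λ : Finset V) {β : ℝ} (hβ : 0 ≤ β) (h : ℝ)
    (bc : BoundaryCondition V) (x y z : V) :
    0 ≤ -(2 * isingExpect Gr Λ β h bc (fun σ => spinAt x σ * spinAt y σ * spinAt z σ)) +
        isingExpect Gr Λ β h bc (fun σ => spinAt x σ * spinAt y σ) +
        isingExpect Gr Λ β h bc (fun σ => spinAt x σ * spinAt z σ) +
        isingExpect Gr Λ β h bc (fun σ => spinAt y σ * spinAt z σ) -
        isingExpect Gr Λ β h bc (spinAt x) * isingExpect Gr Λ β h bc (spinAt y) *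
          isingExpect Gr Λ β h bc (spinAt z) +
        isingExpect Gr Λ β h bc (spinAt x) * isingExpect Gr Λ β h bc (fun σ => spinAt y σ * spinAt z σ) +
        isingExpect Gr Λ β h bc (spinAt y) * isingExpect Gr Λ β h bc (fun σ => spinAt x σ * spinAt z σ) +
        isingExpect Gr Λ β h bc (spinAt z) * isingExpect Gr Λ β h bc (fun σ => spinAt x σ * spinAt y σ) -
        isingExpect Gr Λ β h bc (spinAt x) * isingExpect Gr Λ β h bc (spinAt y) -
        isingExpect Gr Λ β h bc (spinAt x) * isingExpect Gr Λ β h bc (spinAt z) -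
        isingExpect Gr Λ β h bc (spinAt y) * isingExpect Gr Λ β h bc (spinAt z) := by
  set μ : (Λ → ℤˣ) → ℝ := fun τ => isingWeight Gr Λ β h bc τ / isingPartitionFunction Gr Λ β h bc with hμ
  have hFKG : IsFKGMeasure μ := isFKGMeasure_isingGibbsWeight Gr Λ hβ h bc
  set v : Fin 3 → V := ![x, y, z] with hv
  -- the NEGATED spins as functions of `τ`
  set s : Fin 3 → (Λ → ℤˣ) → ℝ := fun a τ => -spinAt (v a) (glue Λ τ bc) with hs
  have key := ising_sahiE_threeSites_nonneg_of_antitone Gr Λ hβ h bc v 3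
    (fun a w => (1 - ((w a : ℤ) : ℝ)) / 2) (fun a w => half_one_sub_units_nonneg (w a))
    (fun a => antitone_half_one_sub_apply a)
  have hfun : (fun (i : Fin 3) (τ : Λ → ℤˣ) => (1 - (((glue Λ τ bc (v i) : ℤˣ) : ℤ) : ℝ)) / 2) =
      fun i => fun τ => (1 + s i τ) / 2 := by
    funext i τ
    simp only [hs, spinAt]
    ring
  rw [hfun, sahiE_three_apply] at key
  rw [ex_half_one_add_mul_three hFKG.sum_eq_one, ex_half_one_add_mul_two hFKG.sum_eq_one,
    ex_half_one_add_mul_two hFKG.sum_eq_one, ex_half_one_add_mul_two hFKG.sum_eq_one,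
    ex_half_one_add hFKG.sum_eq_one, ex_half_one_add hFKG.sum_eq_one,
    ex_half_one_add hFKG.sum_eq_one] at key
  -- moments of the negated spins
  have mx := measurable_spinAt (V := V) x
  have my := measurable_spinAt (V := V) y
  have mz := measurable_spinAt (V := V) z
  have mxy : Measurable fun σ : SpinConfig V => spinAt x σ * spinAt y σ := mx.mul my
  have mxz : Measurable fun σ : SpinConfig V => spinAt x σ * spinAt z σ := mx.mul mz
  have myz : Measurable fun σ : SpinConfig V => spinAt y σ * spinAt z σ := my.mul mz
  have mxyz : Measurable fun σ : SpinConfig V => spinAt x σ * spinAt y σ * spinAt z σ := (mx.mul my).mul mz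
  have h0 : ex μ (fun τ => spinAt x (glue Λ τ bc)) = isingExpect Gr Λ β h bc (spinAt x) :=
    ex_isingGibbsWeight_comp_glue Gr Λ β h bc mx
  have h1 : ex μ (fun τ => spinAt y (glue Λ τ bc)) = isingExpect Gr Λ β h bc (spinAt y) :=
    ex_isingGibbsWeight_comp_glue Gr Λ β h bc my
  have h2 : ex μ (fun τ => spinAt z (glue Λ τ bc)) = isingExpect Gr Λ β h bc (spinAt z) :=
    ex_isingGibbsWeight_comp_glue Gr Λ β h bc mz
  have h01 : ex μ (fun τ => spinAt x (glue Λ τ bc) * spinAt y (glue Λ τ bc)) =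
      isingExpect Gr Λ β h bc (fun σ => spinAt x σ * spinAt y σ) :=
    ex_isingGibbsWeight_comp_glue Gr Λ β h bc mxy
  have h02 : ex μ (fun τ => spinAt x (glue Λ τ bc) * spinAt z (glue Λ τ bc)) =
      isingExpect Gr Λ β h bc (fun σ => spinAt x σ * spinAt z σ) :=
    ex_isingGibbsWeight_comp_glue Gr Λ β h bc mxz
  have h12 : ex μ (fun τ => spinAt y (glue Λ τ bc) * spinAt z (glue Λ τ bc)) =
      isingExpect Gr Λ β h bc (fun σ => spinAt y σ * spinAt z σ) :=
    ex_isingGibbsWeight_comp_glue Gr Λ β h bc myz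
  have h012 : ex μ (fun τ => spinAt x (glue Λ τ bc) * spinAt y (glue Λ τ bc) * spinAt z (glue Λ τ bc)) =
      isingExpect Gr Λ β h bc (fun σ => spinAt x σ * spinAt y σ * spinAt z σ) :=
    ex_isingGibbsWeight_comp_glue Gr Λ β h bc mxyz
  have e0 : ex μ (s 0) = -isingExpect Gr Λ β h bc (spinAt x) := by
    show ex μ (fun τ => -spinAt x (glue Λ τ bc)) = _
    rw [ex_neg', h0]
  have e1 : ex μ (s 1) = -isingExpect Gr Λ β h bc (spinAt y) := by
    show ex μ (fun τ => -spinAt y (glue Λ τ bc)) = _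
    rw [ex_neg', h1]
  have e2 : ex μ (s 2) = -isingExpect Gr Λ β h bc (spinAt z) := by
    show ex μ (fun τ => -spinAt z (glue Λ τ bc)) = _
    rw [ex_neg', h2]
  have e01 : ex μ (s 0 * s 1) = isingExpect Gr Λ β h bc (fun σ => spinAt x σ * spinAt y σ) := by
    show ex μ (fun τ => -spinAt x (glue Λ τ bc) * -spinAt y (glue Λ τ bc)) = _
    rw [← h01]
    congr 1
    funext τ
    ring
  have e02 : ex μ (s 0 * s 2) = isingExpect Gr Λ β h bc (fun σ => spinAt x σ * spinAt z σ) := by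
    show ex μ (fun τ => -spinAt x (glue Λ τ bc) * -spinAt z (glue Λ τ bc)) = _
    rw [← h02]
    congr 1
    funext τ
    ring
  have e12 : ex μ (s 1 * s 2) = isingExpect Gr Λ β h bc (fun σ => spinAt y σ * spinAt z σ) := by
    show ex μ (fun τ => -spinAt y (glue Λ τ bc) * -spinAt z (glue Λ τ bc)) = _
    rw [← h12]
    congr 1
    funext τ
    ring
  have e012 : ex μ (s 0 * s 1 * s 2) =
      -isingExpect Gr Λ β h bc (fun σ => spinAt x σ * spinAt y σ * spinAt z σ) := by
    show ex μ (fun τ => -spinAt x (glue Λ τ bc) * -spinAt y (glue Λ τ bc) * -spinAt z (glue Λ τ bc)) = _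
    rw [← h012, ← ex_neg']
    congr 1
    funext τ
    ring
  rw [e0, e1, e2, e01, e02, e12, e012] at key
  nlinarith [key]

end Dual

end Summit.CriticalPhenomena.PercolationContinuityZ3.Theorems.SahiThreeCoordinates
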